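import Summits.KontsevichZagierPeriods.KontsevichZagierPeriods.Theorems.SoloInformedToricTriCharts
import Summits.KontsevichZagierPeriods.KontsevichZagierPeriods.Theorems.SoloInformedToricDominant
import HarnessLib

/-!
# THEOREM CUSP: the first cube-degenerate denominator, `(x₀ − x₁)² + x₀³`

Solo programme `solo-KontsevichZagierPeriods-informed`, session s105 (cube crux
`SoloInformedAyoubCubeResolutionCube`, first rung OUTSIDE the cube-nondegenerate class).

The cusp denominator `Q = (x₀ − x₁)² + x₀³` vanishes on `[0,1]²` only at the origin, but its
initial form for the weight `(1,1)` is `(x₀ − x₁)²`, which vanishes on the diagonal of `(0,1]²`: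
`Q` is cube-degenerate, and so are its four vertex reflections (`Q(1−x₀, 1−x₁)` vanishes at
`(1,1)`, `in_{(0,1)} Q(1−x₀, x₁) = (1−x₀)²(2−x₀)` at `x₀ = 1`, `in_{(1,0)} Q(x₀, 1−x₁) = (1−x₁)²`
at `x₁ = 1`), so that none of THEOREM TOR / ND-GEN / CORNER / VERTEX applies.  THEOREM DIAG does:
along the triangle charts

* `Q(v₀, v₀v₁) = v₀² ((1 − v₁)² + v₀)`, pulled-back form `P(v₀,v₀v₁) / (v₀ ((1−v₁)² + v₀))`, and
  the vertex reflection `x₁ ↦ 1 − x₁` of `Q₁ = x₀((1−x₁)² + x₀)` is `x₀ (x₀ + x₁²)`,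
  cube-nondegenerate (LEMMA DOM);
* `Q(u₀u₁, u₁) = u₁² ((1 − u₀)² + u₀³u₁)`, pulled-back form `P(u₀u₁,u₁) / (u₁ ((1−u₀)² + u₀³u₁))`,
  and the vertex reflection `x₀ ↦ 1 − x₀` of `Q₂ = x₁((1−x₀)² + x₀³x₁)` is
  `x₁ (x₀² + x₁(1−x₀)³) = x₁ · cuspChartDen`, cube-nondegenerate (LEMMA DOM, mixed signs).

Hence **THEOREM CUSP** `soloInformed_presentable_cusp`: `[σ, P/((x₀−x₁)²+x₀³)]` is presentable
(`k = 1`) for every numerator `P ∈ ℚ[x₀,x₁]` and every `(0,1)² ⊆ σ ⊆ [0,1]²` on which it is an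
`IntegralRep`; a hypothesis-free instance is the bounded integrand `x₀³/((x₀−x₁)²+x₀³)` on the
open square (`soloInformedCuspRep`, `soloInformed_presentable_cuspRep`).

References: M. Kontsevich, D. Zagier, *Periods* (2001) §1.2; A. N. Varchenko, Funct. Anal.
Appl. 10 (1976); J. Ayoub, EMS Newsl. 91 (2014) §2.2.
-/

noncomputable section

open scoped BigOperators
open MeasureTheory Set
open Literature.NumberTheory.Transcendental Literature.NumberTheory.Transcendental.KZ
open Literature.ModelTheory.ExponentialFields (IsSemialgebraic)

namespace Summit.KontsevichZagierPeriods.KontsevichZagierPeriods.Theorems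

/-! ## The cusp denominator and its chart denominators -/

/-- The cusp denominator `(x₀ − x₁)² + x₀³`. -/
def soloInformedCuspDen : MvPolynomial (Fin 2) ℚ :=
  (MvPolynomial.X 0 - MvPolynomial.X 1) ^ 2 + MvPolynomial.X 0 ^ 3

/-- The lower-chart denominator `Q₁ = x₀ ((1 − x₁)² + x₀)`. -/
def soloInformedCuspLowerDen : MvPolynomial (Fin 2) ℚ :=
  MvPolynomial.X 0 * ((1 - MvPolynomial.X 1) ^ 2 + MvPolynomial.X 0)

/-- The upper-chart denominator `Q₂ = x₁ ((1 − x₀)² + x₀³ x₁)`. -/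
def soloInformedCuspUpperDen : MvPolynomial (Fin 2) ℚ :=
  MvPolynomial.X 1 * ((1 - MvPolynomial.X 0) ^ 2 + MvPolynomial.X 0 ^ 3 * MvPolynomial.X 1)

/-- Evaluation of the cusp denominator. -/
theorem soloInformed_aeval_cuspDen (x : Fin 2 → ℝ) :
    MvPolynomial.aeval x soloInformedCuspDen = (x 0 - x 1) ^ 2 + x 0 ^ 3 := by
  simp [soloInformedCuspDen]

/-- Evaluation of the lower-chart denominator. -/
theorem soloInformed_aeval_cuspLowerDen (x : Fin 2 → ℝ) :
    MvPolynomial.aeval x soloInformedCuspLowerDen = x 0 * ((1 - x 1) ^ 2 + x 0) := by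
  simp [soloInformedCuspLowerDen]

/-- Evaluation of the upper-chart denominator. -/
theorem soloInformed_aeval_cuspUpperDen (x : Fin 2 → ℝ) :
    MvPolynomial.aeval x soloInformedCuspUpperDen = x 1 * ((1 - x 0) ^ 2 + x 0 ^ 3 * x 1) := by
  simp [soloInformedCuspUpperDen]

/-- The cusp denominator vanishes on the closed square only at the origin. [this work] -/
theorem soloInformed_aeval_cuspDen_eq_zero_iff (x : Fin 2 → ℝ) (hx : ∀ i, 0 ≤ x i ∧ x i ≤ 1) :
    MvPolynomial.aeval x soloInformedCuspDen = 0 ↔ x = 0 := by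
  rw [soloInformed_aeval_cuspDen]
  constructor
  · intro h
    have h0 : 0 ≤ x 0 := (hx 0).1
    have h3 : x 0 ^ 3 = 0 := by nlinarith [sq_nonneg (x 0 - x 1), pow_nonneg h0 3]
    have hx0 : x 0 = 0 := (pow_eq_zero_iff three_ne_zero).1 h3
    have hx1 : x 1 = 0 := by
      rw [hx0] at h
      nlinarith [sq_nonneg (x 1)]
    exact funext fun i => by fin_cases i <;> simp [hx0, hx1]
  · rintro rfl
    simp

/-- The cusp denominator is positive on the open square. -/
theorem soloInformed_aeval_cuspDen_pos {x : Fin 2 → ℝ} (hx : x ∈ soloInformedOpenCube 2) :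
    0 < MvPolynomial.aeval x soloInformedCuspDen := by
  rw [soloInformed_aeval_cuspDen]
  have h0 := (hx 0).1
  positivity

/-- `Q(v₀, v₀v₁) = v₀² ((1 − v₁)² + v₀)`. [this work] -/
theorem soloInformed_aeval_cuspDen_lowerChart (v : Fin 2 → ℝ) :
    MvPolynomial.aeval (fun i => ∏ j, v j ^ soloInformedLowerMat i j) soloInformedCuspDen =
      v 0 ^ 2 * ((1 - v 1) ^ 2 + v 0) := by
  simp only [soloInformedCuspDen, map_add, map_sub, map_pow, MvPolynomial.aeval_X,
    soloInformed_prod_lowerMat_zero, soloInformed_prod_lowerMat_one]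
  ring

/-- `Q(u₀u₁, u₁) = u₁² ((1 − u₀)² + u₀³ u₁)`. [this work] -/
theorem soloInformed_aeval_cuspDen_upperChart (v : Fin 2 → ℝ) :
    MvPolynomial.aeval (fun i => ∏ j, v j ^ soloInformedUpperMat i j) soloInformedCuspDen =
      v 1 ^ 2 * ((1 - v 0) ^ 2 + v 0 ^ 3 * v 1) := by
  simp only [soloInformedCuspDen, map_add, map_sub, map_pow, MvPolynomial.aeval_X,
    soloInformed_prod_upperMat_zero, soloInformed_prod_upperMat_one]
  ring

/-- The pulled-back form along the lower chart: `f(v₀, v₀v₁) v₀ = P_low(v) / Q₁(v)`. [this work] -/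
theorem soloInformed_cusp_lowerChart_form (P : MvPolynomial (Fin 2) ℚ) (v : Fin 2 → ℝ)
    (hv : v ∈ soloInformedOpenCube 2) :
    MvPolynomial.aeval (fun i => ∏ j, v j ^ soloInformedLowerMat i j) P /
        MvPolynomial.aeval (fun i => ∏ j, v j ^ soloInformedLowerMat i j) soloInformedCuspDen *
          v 0 =
      MvPolynomial.aeval v (soloInformedChartQuot soloInformedLowerMat P 0) /
        MvPolynomial.aeval v soloInformedCuspLowerDen := by
  rw [soloInformed_aeval_cuspDen_lowerChart,
    soloInformed_aeval_monomialMap_chartQuot_zero soloInformedLowerMat P v,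
    soloInformed_aeval_cuspLowerDen]
  have h0 : v 0 ≠ 0 := (hv 0).1.ne'
  have hq : (1 - v 1) ^ 2 + v 0 ≠ 0 := by
    have := (hv 0).1
    positivity
  field_simp

/-- The pulled-back form along the upper chart: `f(u₀u₁, u₁) u₁ = P_up(u) / Q₂(u)`. [this work] -/
theorem soloInformed_cusp_upperChart_form (P : MvPolynomial (Fin 2) ℚ) (v : Fin 2 → ℝ)
    (hv : v ∈ soloInformedOpenCube 2) :
    MvPolynomial.aeval (fun i => ∏ j, v j ^ soloInformedUpperMat i j) P /
        MvPolynomial.aeval (fun i => ∏ j, v j ^ soloInformedUpperMat i j) soloInformedCuspDen *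
          v 1 =
      MvPolynomial.aeval v (soloInformedChartQuot soloInformedUpperMat P 0) /
        MvPolynomial.aeval v soloInformedCuspUpperDen := by
  rw [soloInformed_aeval_cuspDen_upperChart,
    soloInformed_aeval_monomialMap_chartQuot_zero soloInformedUpperMat P v,
    soloInformed_aeval_cuspUpperDen]
  have h1 : v 1 ≠ 0 := (hv 1).1.ne'
  have hq : (1 - v 0) ^ 2 + v 0 ^ 3 * v 1 ≠ 0 := by
    have := (hv 0).1
    have := (hv 1).1
    positivity
  field_simp

/-! ## Vertex reflections of the chart denominators are cube-nondegenerate -/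

/-- `Q₁(x₀, 1 − x₁) = x₀ (x₀ + x₁²)`. [this work] -/
theorem soloInformed_vertexReflect_cuspLowerDen :
    soloInformedVertexReflect ({1} : Finset (Fin 2)) soloInformedCuspLowerDen =
      MvPolynomial.X 0 * (MvPolynomial.X 0 + MvPolynomial.X 1 ^ 2) := by
  simp only [soloInformedCuspLowerDen, map_mul, map_add, map_sub, map_pow, map_one,
    soloInformed_vertexReflect_X, Finset.mem_singleton, if_true,
    show ((0 : Fin 2) = 1) = False from by simp, if_false]
  ring

/-- `Q₂(1 − x₀, x₁) = x₁ (x₀² + x₁ (1 − x₀)³) = x₁ · cuspChartDen`. [this work] -/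
theorem soloInformed_vertexReflect_cuspUpperDen :
    soloInformedVertexReflect ({0} : Finset (Fin 2)) soloInformedCuspUpperDen =
      MvPolynomial.X 1 * soloInformedCuspChartDen := by
  unfold soloInformedCuspChartDen
  simp only [soloInformedCuspUpperDen, map_mul, map_add, map_sub, map_pow, map_one,
    soloInformed_vertexReflect_X, Finset.mem_singleton, if_true,
    show ((1 : Fin 2) = 0) = False from by simp, if_false]
  ring

/-- The vertex reflection `x₁ ↦ 1 − x₁` of `Q₁` is cube-nondegenerate. [this work] -/
theorem soloInformed_cubeNondegenerate_vertexReflect_cuspLowerDen :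
    SoloInformedCubeNondegenerate
      (soloInformedVertexReflect ({1} : Finset (Fin 2)) soloInformedCuspLowerDen) := by
  rw [soloInformed_vertexReflect_cuspLowerDen]
  exact soloInformed_cubeNondegenerate_mul (soloInformed_cubeNondegenerate_X 0)
    soloInformed_cubeNondegenerate_XAddSq

/-- The vertex reflection `x₀ ↦ 1 − x₀` of `Q₂` is cube-nondegenerate. [this work] -/
theorem soloInformed_cubeNondegenerate_vertexReflect_cuspUpperDen :
    SoloInformedCubeNondegenerate
      (soloInformedVertexReflect ({0} : Finset (Fin 2)) soloInformedCuspUpperDen) := by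
  rw [soloInformed_vertexReflect_cuspUpperDen]
  exact soloInformed_cubeNondegenerate_mul (soloInformed_cubeNondegenerate_X 1)
    soloInformed_cubeNondegenerate_cuspChartDen

/-! ## THEOREM CUSP -/

/-- **THEOREM CUSP.**  For every numerator `P ∈ ℚ[x₀, x₁]` and every `IntegralRep` `r = [σ, f]`
with `(0,1)² ⊆ σ ⊆ [0,1]²` and `f = P / ((x₀ − x₁)² + x₀³)` on the open square, `of r` is
presentable: modulo `KZ.relations` it is a `ℤ`-combination of cube integrals of real parts of
germs holomorphic near closed cubes (the cube crux with `k = 1`), although the denominator and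
all its vertex reflections are cube-degenerate. [this work] -/
theorem soloInformed_presentable_cusp (P : MvPolynomial (Fin 2) ℚ) (r : IntegralRep 2)
    (hO : soloInformedOpenCube 2 ⊆ r.domain) (hC : r.domain ⊆ soloInformedCube 2)
    (hri : EqOn r.integrand
      (fun x => MvPolynomial.aeval x P / MvPolynomial.aeval x soloInformedCuspDen)
      (soloInformedOpenCube 2)) :
    of r ∈ soloInformedPresentable :=
  soloInformed_presentable_of_diagonalCharts_vertex P soloInformedCuspDen
    (soloInformedChartQuot soloInformedLowerMat P 0) soloInformedCuspLowerDen
    (soloInformedChartQuot soloInformedUpperMat P 0) soloInformedCuspUpperDen {1} {0}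
    soloInformed_cubeNondegenerate_vertexReflect_cuspLowerDen
    soloInformed_cubeNondegenerate_vertexReflect_cuspUpperDen
    (soloInformed_cusp_lowerChart_form P) (soloInformed_cusp_upperChart_form P) r hO hC hri

/-- THEOREM CUSP on the closed square, in the output format of the cube crux
`SoloInformedAyoubCubeResolutionCube` (`k = 1`). [this work] -/
theorem soloInformed_cubeResolution_cusp (P : MvPolynomial (Fin 2) ℚ) (r : IntegralRep 2)
    (hr : r.domain = soloInformedCube 2)
    (hri : EqOn r.integrand
      (fun x => MvPolynomial.aeval x P / MvPolynomial.aeval x soloInformedCuspDen)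
      (soloInformedOpenCube 2)) :
    ∃ (k : ℕ) (_ : k ≠ 0) (m' : ℕ) (d : Fin m' → ℕ) (G : ∀ j, SoloInformedCubeGerm (d j))
      (c : Fin m' → ℤ) (ρ : ∀ j, IntegralRep (d j)),
      (∀ j, (ρ j).domain = soloInformedCube (d j)) ∧
      (∀ j, EqOn (ρ j).integrand (fun x => ((G j).g (soloInformedToC (d j) x)).re)
        (soloInformedCube (d j))) ∧
      k • of r - ∑ j, c j • of (ρ j) ∈ relations :=
  soloInformed_exists_fin_of_presentable
    (soloInformed_presentable_cusp P r (hr ▸ soloInformedOpenCube_subset_cube 2) hr.le hri)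

/-! ## A hypothesis-free instance: `[(0,1)², x₀³ / ((x₀ − x₁)² + x₀³)]` -/

/-- `x₀³ / ((x₀ − x₁)² + x₀³)` is integrable on the open square (it is measurable and bounded
by `1`). [this work] -/
theorem soloInformed_integrableOn_cusp :
    IntegrableOn (fun x : Fin 2 → ℝ =>
      MvPolynomial.aeval x (MvPolynomial.X 0 ^ 3 : MvPolynomial (Fin 2) ℚ) /
        MvPolynomial.aeval x soloInformedCuspDen) (soloInformedOpenCube 2) := by
  have hf : (fun x : Fin 2 → ℝ =>
      MvPolynomial.aeval x (MvPolynomial.X 0 ^ 3 : MvPolynomial (Fin 2) ℚ) /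
        MvPolynomial.aeval x soloInformedCuspDen) =
      fun x => x 0 ^ 3 / ((x 0 - x 1) ^ 2 + x 0 ^ 3) := by
    funext x
    rw [soloInformed_aeval_cuspDen, map_pow, MvPolynomial.aeval_X]
  rw [hf]
  have hmeas : Measurable fun x : Fin 2 → ℝ => x 0 ^ 3 / ((x 0 - x 1) ^ 2 + x 0 ^ 3) :=
    ((measurable_pi_apply 0).pow_const 3).div
      ((((measurable_pi_apply 0).sub (measurable_pi_apply 1)).pow_const 2).add
        ((measurable_pi_apply 0).pow_const 3))
  have hfin : volume (soloInformedOpenCube 2) ≠ ⊤ := by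
    refine (lt_of_le_of_lt (measure_mono (soloInformedOpenCube_subset_cube 2)) ?_).ne
    rw [soloInformedCube_eq_Icc]
    exact measure_Icc_lt_top
  have hmeasO : MeasurableSet (soloInformedOpenCube 2) := by
    rw [soloInformedOpenCube_eq_pi]; exact MeasurableSet.univ_pi fun _ => measurableSet_Ioo
  refine Measure.integrableOn_of_bounded (M := 1) hfin hmeas.aestronglyMeasurable
    ((ae_restrict_iff' hmeasO).2 (Filter.Eventually.of_forall fun x hx => ?_))
  have h0 : 0 < x 0 := (hx 0).1
  have hden : 0 < (x 0 - x 1) ^ 2 + x 0 ^ 3 := by positivity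
  rw [Real.norm_eq_abs, abs_of_nonneg (div_nonneg (pow_nonneg h0.le 3) hden.le)]
  exact div_le_one_of_le₀ (le_add_of_nonneg_left (sq_nonneg _)) hden.le

/-- The cusp integral `[(0,1)², x₀³ / ((x₀ − x₁)² + x₀³)]` as an `IntegralRep` in KZ's literal
rational shape. [this work] -/
def soloInformedCuspRep : IntegralRep 2 :=
  IntegralRep.ofRational (soloInformedOpenCube 2) (MvPolynomial.X 0 ^ 3) soloInformedCuspDen
    (isSemialgebraic_soloInformedOpenCube 2)
    (fun _ hx => (soloInformed_aeval_cuspDen_pos hx).ne') soloInformed_integrableOn_cusp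

/-- **The cusp integral is presentable** (no hypotheses): `of [(0,1)², x₀³/((x₀−x₁)²+x₀³)]`
is, modulo `KZ.relations`, a `ℤ`-combination of cube integrals of real parts of germs
holomorphic near closed cubes. [this work] -/
theorem soloInformed_presentable_cuspRep : of soloInformedCuspRep ∈ soloInformedPresentable :=
  soloInformed_presentable_cusp (MvPolynomial.X 0 ^ 3) soloInformedCuspRep subset_rfl
    (soloInformedOpenCube_subset_cube 2) fun _ _ => rfl

end Summit.KontsevichZagierPeriods.KontsevichZagierPeriods.Theorems
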